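import Summits.Ventures.Crystal3D.Bulk.CapX2Dense
import HarnessLib

/-!
# X2 certificates: the pair and triple polynomials as kernel data (`P + λ`, `S₃ − ε₃` as dense tensors)

HONEST FRAMING. Venture `Summits/Ventures/Crystal3D` (cell `pub-crystal3d`, phase 2; seat p1). Bookkeeping
for the kernel replay of inequalities (II) and (III) of an X2 certificate (lead g5 03:46:24Z: primary
target `certU061`, replay by typer-bulk's tensor-Bernstein branch-and-bound / p2's SOS identity). Those
checkers are generic over «a trivariate polynomial given as kernel data with a proven evaluation»; this
file supplies exactly that for an `X2Cert` (`Bulk/CapX2Cert.lean`):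
* (on the dense representation `P3` of `Bulk/CapX2Dense.lean`, `u`-major)
* the zonal factors `Q3 k` at polynomial arguments by the Chebyshev recurrence (`q3Seq`, `eval3_q3P`);
* `sPoly3` = a factored pole kernel `poleKernel3` at polynomial arguments (`eval3_sPoly3`), `kPoly3` = the
  cap kernel (`eval3_kPoly3`);
* **`pairPolyZ c λ`** with `eval3 (pairPolyZ c λ) u v t = c.pairPoly u v t + λ` and **`tripleZ c ε₃`** with
  `eval3 (tripleZ c ε₃) a b d = c.tripleSym a b d − ε₃`; hence
  `ineqII_of_forall_pairPolyZ` / `ineqIII_of_forall_tripleZ`: a proof that the DATA polynomial is `≤ 0` on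
  the half / sorted region gives `c.IneqII s λ` / `c.IneqIII s ε₃`.
All definitions are structural recursions on lists of rationals (`decide +kernel`-evaluable). NO inequality
is checked here. A bridge to another dense layout is a transpose with a one-line evaluation lemma.
-/

open Finset
open Literature.Geometry.DiscreteGeometry Literature.Geometry.DiscreteGeometry.BachocVallentin
open Summit.Ventures.Crystal3D.CapCut

namespace Summit.Ventures.Crystal3D.CapX2

/-! ### The zonal factors at polynomial arguments -/

/-- The Chebyshev recurrence on `P3`: `q3Seq x y n = (Q_n, Q_{n+1})` with `Q₀ = 1`, `Q₁ = x`,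
`Q_{k+2} = 2x·Q_{k+1} − y·Q_k`. -/
def q3Seq (x y : P3) : ℕ → P3 × P3
  | 0 => (cst3 1, x)
  | n + 1 =>
    let p := q3Seq x y n
    (p.2, add3 (scale3 2 (mul3 x p.2)) (scale3 (-1) (mul3 y p.1)))

/-- `Q3 k` at polynomial arguments `A, B, C`: `x = C − A·B`, `y = (1 − A²)(1 − B²)`. -/
def q3P (A B C : P3) (k : ℕ) : P3 :=
  (q3Seq (add3 C (scale3 (-1) (mul3 A B)))
    (mul3 (add3 (cst3 1) (scale3 (-1) (mul3 A A))) (add3 (cst3 1) (scale3 (-1) (mul3 B B)))) k).1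

/-- The recurrence evaluates to `chebHom` (both components). -/
private theorem eval3_q3Seq (x y : P3) (u v t : ℝ) (n : ℕ) :
    eval3 (q3Seq x y n).1 u v t =
        Literature.Analysis.SpecialFunctions.chebHom n (2 * eval3 x u v t) (eval3 y u v t) ∧
      eval3 (q3Seq x y n).2 u v t =
        Literature.Analysis.SpecialFunctions.chebHom (n + 1) (2 * eval3 x u v t) (eval3 y u v t) := by
  induction n with
  | zero =>
    refine ⟨?_, ?_⟩
    · simp [q3Seq, eval3_cst3, Literature.Analysis.SpecialFunctions.chebHom]
    · simp [q3Seq, Literature.Analysis.SpecialFunctions.chebHom]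
  | succ n ih =>
    obtain ⟨h1, h2⟩ := ih
    refine ⟨by simpa [q3Seq] using h2, ?_⟩
    show eval3 (add3 (scale3 2 (mul3 x (q3Seq x y n).2)) (scale3 (-1) (mul3 y (q3Seq x y n).1))) u v t = _
    rw [eval3_add3, eval3_scale3, eval3_scale3, eval3_mul3, eval3_mul3, h1, h2,
      show n + 1 + 1 = n + 2 from rfl, Literature.Analysis.SpecialFunctions.chebHom]
    push_cast; ring

/-- `q3P A B C k` evaluates to `Q3 k (A) (B) (C)`. -/
theorem eval3_q3P (A B C : P3) (k : ℕ) (u v t : ℝ) :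
    eval3 (q3P A B C k) u v t = Q3 k (eval3 A u v t) (eval3 B u v t) (eval3 C u v t) := by
  unfold q3P Q3
  rw [(eval3_q3Seq _ _ u v t k).1, eval3_add3, eval3_scale3, eval3_mul3, eval3_mul3, eval3_add3,
    eval3_add3, eval3_scale3, eval3_scale3, eval3_mul3, eval3_mul3, eval3_cst3]
  congr 1 <;> push_cast <;> ring

/-! ### Factored kernels at polynomial arguments -/

/-- A factored pole kernel at polynomial arguments:
`Σ_{k<KX} (Σ_{r<RX} eA (colA k r) · eB (colB k r)) · Q3_k(A, B, C)` — the column polynomials `colA`,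
`colB` (coefficient lists) composed with the argument embeddings `eA`, `eB`. -/
def sPoly3 (KX RX : ℕ) (colA colB : ℕ → ℕ → List ℚ) (eA eB : List ℚ → P3) (A B C : P3) : P3 :=
  sum3 (fun k => mul3 (sum3 (fun r => mul3 (eA (colA k r)) (eB (colB k r))) RX) (q3P A B C k)) KX

/-- `sPoly3` evaluates to `poleKernel3` at the argument values. -/
theorem eval3_sPoly3 (KX RX : ℕ) (colA colB : ℕ → ℕ → List ℚ) (eA eB : List ℚ → P3) (A B C : P3)
    (f g : ℕ → ℕ → ℝ → ℝ) (u v t α β γ : ℝ)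
    (hA : eval3 A u v t = α) (hB : eval3 B u v t = β) (hC : eval3 C u v t = γ)
    (heA : ∀ k r, eval3 (eA (colA k r)) u v t = f k r α)
    (heB : ∀ k r, eval3 (eB (colB k r)) u v t = g k r β) :
    eval3 (sPoly3 KX RX colA colB eA eB A B C) u v t = poleKernel3 KX RX f g α β γ := by
  unfold sPoly3 poleKernel3
  rw [eval3_sum3]
  refine Finset.sum_congr rfl fun k _ => ?_
  rw [eval3_mul3, eval3_sum3, eval3_q3P, hA, hB, hC, Finset.sum_mul]
  refine Finset.sum_congr rfl fun r _ => ?_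
  rw [eval3_mul3, heA, heB]

/-- The cap kernel `K_p(u,v,t)` of a `CapCert` as a `P3` (columns `g_{k,r}` from p3's `gPolyN`). -/
def kPoly3 (c : CapCert) : P3 :=
  sPoly3 c.L.length c.R (fun k r => gPolyN c k r (c.rows k)) (fun k r => gPolyN c k r (c.rows k))
    ofU ofV (ofU [0, 1]) (ofV [0, 1]) (ofT [0, 1])

/-- `kPoly3` evaluates to the certificate's cap kernel. -/
theorem eval3_kPoly3 (c : CapCert) (u v t : ℝ) : eval3 (kPoly3 c) u v t = c.kernel u v t := by
  unfold kPoly3 CapCert.kernel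
  rw [capKernel3_eq]
  refine eval3_sPoly3 _ _ _ _ _ _ _ _ _ c.g c.g u v t u v t ?_ ?_ ?_ ?_ ?_
  · simp [eval3_ofU, upolyEval]
  · simp [eval3_ofV, upolyEval]
  · simp [eval3_ofT, upolyEval]
  · intro k r; rw [eval3_ofU, eval_gPolyN_rows]
  · intro k r; rw [eval3_ofV, eval_gPolyN_rows]
where
  /-- `capKernel3` is the diagonal pole kernel (restated to avoid unfolding under binders). -/
  capKernel3_eq : capKernel3 c.L.length c.R c.g = poleKernel3 c.L.length c.R c.g c.g := rfl

/-! ### The pair and triple polynomials of an X2 certificate -/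

/-- Embedding «constant = value at `1`» of a column polynomial. -/
def atOne (l : List ℚ) : P3 := cst3 (qevalOne l)

/-- `atOne` evaluates to the value at `1`. -/
theorem eval3_atOne (l : List ℚ) (u v t : ℝ) : eval3 (atOne l) u v t = upolyEval l 1 := by
  rw [atOne, eval3_cst3, cast_qevalOne]

/-- Embedding «at `−u`». -/
def negU (l : List ℚ) : P3 := ofU (pflip l)

/-- `negU` evaluates at `−u`. -/
theorem eval3_negU (l : List ℚ) (u v t : ℝ) : eval3 (negU l) u v t = upolyEval l (-u) := by
  rw [negU, eval3_ofU, eval_pflip]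

/-- Embedding «at `−v`». -/
def negV (l : List ℚ) : P3 := ofV (pflip l)

/-- `negV` evaluates at `−v`. -/
theorem eval3_negV (l : List ℚ) (u v t : ℝ) : eval3 (negV l) u v t = upolyEval l (-v) := by
  rw [negV, eval3_ofV, eval_pflip]

/-- The variable `u`. -/
def pU : P3 := ofU [0, 1]
/-- The variable `v`. -/
def pV : P3 := ofV [0, 1]
/-- The variable `t`. -/
def pT : P3 := ofT [0, 1]
/-- The constant `1`. -/
def pOne : P3 := cst3 1

/-- `pU` evaluates to `u`. -/
@[simp] theorem eval3_pU (u v t : ℝ) : eval3 pU u v t = u := by simp [pU, eval3_ofU, upolyEval]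
/-- `pV` evaluates to `v`. -/
@[simp] theorem eval3_pV (u v t : ℝ) : eval3 pV u v t = v := by simp [pV, eval3_ofV, upolyEval]
/-- `pT` evaluates to `t`. -/
@[simp] theorem eval3_pT (u v t : ℝ) : eval3 pT u v t = t := by simp [pT, eval3_ofT, upolyEval]
/-- `pOne` evaluates to `1`. -/
@[simp] theorem eval3_pOne (u v t : ℝ) : eval3 pOne u v t = 1 := by simp [pOne, eval3_cst3]
/-- `-pU` evaluates to `-u`. -/
@[simp] theorem eval3_negpU (u v t : ℝ) : eval3 (scale3 (-1) pU) u v t = -u := by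
  simp [eval3_scale3]
/-- `-pV` evaluates to `-v`. -/
@[simp] theorem eval3_negpV (u v t : ℝ) : eval3 (scale3 (-1) pV) u v t = -v := by
  simp [eval3_scale3]

/-- The X2 block `S_ab` at polynomial arguments, columns read from the certificate. -/
def sX (c : X2Cert) (colA colB : ℕ → ℕ → List ℚ) (eA eB : List ℚ → P3) (A B C : P3) : P3 :=
  sPoly3 c.KX c.RX colA colB eA eB A B C

/-- The `a`-columns of an X2 certificate as coefficient lists. -/
def colA (c : X2Cert) (k r : ℕ) : List ℚ := aPolyN c k r (c.rowsX k)
/-- The `b`-columns of an X2 certificate as coefficient lists. -/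
def colB (c : X2Cert) (k r : ℕ) : List ℚ := bPolyN c k r (c.rowsX k)

/-- **THE PAIR POLYNOMIAL AS DATA**: `pairPolyZ c λ`, a `P3` with
`eval3 (pairPolyZ c λ) u v t = P(u,v,t) + λ`. -/
def pairPolyZ (c : X2Cert) (lam : ℚ) : P3 :=
  add3 (kPoly3 c.cap)
    (add3 (sX c (colA c) (colA c) atOne ofT pOne pT pT)
    (add3 (sX c (colA c) (colA c) ofT atOne pT pOne pT)
    (add3 (sX c (colA c) (colA c) ofT ofT pT pT pOne)
    (add3 (sX c (colA c) (colB c) ofT negU pT (scale3 (-1) pU) (scale3 (-1) pV))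
    (add3 (sX c (colA c) (colB c) ofT negV pT (scale3 (-1) pV) (scale3 (-1) pU))
      (cst3 lam))))))

/-- `pairPolyZ` evaluates to `P + λ`. -/
theorem eval3_pairPolyZ (c : X2Cert) (lam : ℚ) (u v t : ℝ) :
    eval3 (pairPolyZ c lam) u v t = c.pairPoly u v t + lam := by
  have ha : ∀ k r A, upolyEval (colA c k r) A = c.a k r A := fun k r A => eval_aPolyN_rows c k r A
  have hb : ∀ k r A, upolyEval (colB c k r) A = c.b k r A := fun k r A => eval_bPolyN_rows c k r A
  unfold pairPolyZ X2Cert.pairPoly X2Cert.kernel X2Cert.S11 X2Cert.S12 sX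
  simp only [eval3_add3, eval3_kPoly3, eval3_cst3]
  rw [eval3_sPoly3 _ _ _ _ _ _ _ _ _ c.a c.a u v t 1 t t (by simp) (by simp) (by simp)
      (fun k r => by rw [eval3_atOne, ha]) (fun k r => by rw [eval3_ofT, ha]),
    eval3_sPoly3 _ _ _ _ _ _ _ _ _ c.a c.a u v t t 1 t (by simp) (by simp) (by simp)
      (fun k r => by rw [eval3_ofT, ha]) (fun k r => by rw [eval3_atOne, ha]),
    eval3_sPoly3 _ _ _ _ _ _ _ _ _ c.a c.a u v t t t 1 (by simp) (by simp) (by simp)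
      (fun k r => by rw [eval3_ofT, ha]) (fun k r => by rw [eval3_ofT, ha]),
    eval3_sPoly3 _ _ _ _ _ _ _ _ _ c.a c.b u v t t (-u) (-v) (by simp) (by simp) (by simp)
      (fun k r => by rw [eval3_ofT, ha]) (fun k r => by rw [eval3_negU, hb]),
    eval3_sPoly3 _ _ _ _ _ _ _ _ _ c.a c.b u v t t (-v) (-u) (by simp) (by simp) (by simp)
      (fun k r => by rw [eval3_ofT, ha]) (fun k r => by rw [eval3_negV, hb])]
  ring

/-- **THE TRIPLE POLYNOMIAL AS DATA**: `tripleZ c ε₃`, a `P3` (in the variables `(a, b, d) = (u, v, t)`)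
with `eval3 (tripleZ c ε₃) a b d = S₃(a,b,d) − ε₃`. -/
def tripleZ (c : X2Cert) (eps3 : ℚ) : P3 :=
  add3 (sX c (colA c) (colA c) ofU ofV pU pV pT)
    (add3 (sX c (colA c) (colA c) ofU ofT pU pT pV)
    (add3 (sX c (colA c) (colA c) ofV ofT pV pT pU)
      (cst3 (-eps3))))

/-- `tripleZ` evaluates to `S₃ − ε₃`. -/
theorem eval3_tripleZ (c : X2Cert) (eps3 : ℚ) (a' b' d' : ℝ) :
    eval3 (tripleZ c eps3) a' b' d' = c.tripleSym a' b' d' - eps3 := by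
  have ha : ∀ k r A, upolyEval (colA c k r) A = c.a k r A := fun k r A => eval_aPolyN_rows c k r A
  unfold tripleZ X2Cert.tripleSym X2Cert.S11 sX
  simp only [eval3_add3, eval3_cst3]
  rw [eval3_sPoly3 _ _ _ _ _ _ _ _ _ c.a c.a a' b' d' a' b' d' (by simp) (by simp) (by simp)
      (fun k r => by rw [eval3_ofU, ha]) (fun k r => by rw [eval3_ofV, ha]),
    eval3_sPoly3 _ _ _ _ _ _ _ _ _ c.a c.a a' b' d' a' d' b' (by simp) (by simp) (by simp)
      (fun k r => by rw [eval3_ofU, ha]) (fun k r => by rw [eval3_ofT, ha]),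
    eval3_sPoly3 _ _ _ _ _ _ _ _ _ c.a c.a a' b' d' b' d' a' (by simp) (by simp) (by simp)
      (fun k r => by rw [eval3_ofV, ha]) (fun k r => by rw [eval3_ofT, ha])]
  push_cast; ring

/-! ### From the data polynomials to (II) and (III) -/

/-- **(II) from the data polynomial on the half-domain**: if `eval3 (pairPolyZ c λ) ≤ 0` for
`u₀ ≤ u ≤ v ≤ 1`, `-1 ≤ t ≤ s`, `Gram ≥ 0`, then `c.IneqII s λ`. -/
theorem ineqII_of_forall_pairPolyZ (c : X2Cert) (s lam : ℚ)
    (h : ∀ u v t : ℝ, (c.u0 : ℝ) ≤ u → u ≤ v → v ≤ 1 → -1 ≤ t → t ≤ s →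
      0 ≤ 1 + 2 * u * v * t - u ^ 2 - v ^ 2 - t ^ 2 → eval3 (pairPolyZ c lam) u v t ≤ 0) :
    c.IneqII s lam := by
  refine ineqII_of_half c s lam fun u v t hu huv hv ht hts hg => ?_
  have h0 := h u v t hu huv hv ht hts hg
  rw [eval3_pairPolyZ] at h0
  linarith

/-- **(III) from the data polynomial on the sorted domain**: if `eval3 (tripleZ c ε₃) ≤ 0` for
`-1 ≤ a ≤ b ≤ d ≤ s`, `Gram ≥ 0`, then `c.IneqIII s ε₃`. -/
theorem ineqIII_of_forall_tripleZ (c : X2Cert) (s eps3 : ℚ)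
    (h : ∀ a' b' d' : ℝ, -1 ≤ a' → a' ≤ b' → b' ≤ d' → d' ≤ s →
      0 ≤ 1 + 2 * a' * b' * d' - a' ^ 2 - b' ^ 2 - d' ^ 2 → eval3 (tripleZ c eps3) a' b' d' ≤ 0) :
    c.IneqIII s eps3 := by
  refine ineqIII_of_sorted c s eps3 fun a' b' d' ha hab hbd hds hg => ?_
  have h0 := h a' b' d' ha hab hbd hds hg
  rw [eval3_tripleZ] at h0
  linarith

end Summit.Ventures.Crystal3D.CapX2
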